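import Mathlib.AlgebraicGeometry.Properties
import Mathlib.AlgebraicGeometry.Morphisms.OpenImmersion
import Literature.AlgebraicGeometry.Resolution.ResolutionOfSingularities
import Summits.ResolutionOfSingularities.ResolutionOfSingularities.Theorems.FrobeniusLadderFRationalResolutionRungsIff
import HarnessLib

/-!
# A model of an integral scheme with domain stalks is integral (crux `FRationalResolution`, line `Sketch`)

Stub `isIntegral_of_model` of the skeleton `Sketch` for crux stmt-ResolutionOfSingularities-15317
(route `FrobeniusLadder`, rank-4 crux `FRationalResolution`). Let `X` be an integral scheme and
`π : X' ⟶ X` a morphism which is an isomorphism over a nonempty open `U ⊆ X` whose preimage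
`π ⁻¹ᵁ U` is dense in `X'`, and suppose every stalk of `X'` is a domain. Then `X'` is integral:

* `X'` is reduced because its stalks are domains (`isReduced_of_isDomain_stalk`);
* `X'` is irreducible: the open subscheme `↑U` of the integral `X` is integral (it is nonempty),
  hence so is `↑(π ⁻¹ᵁ U) ≅ ↑U` (transport along the isomorphism `π ∣_ U`); so the subset
  `π ⁻¹ᵁ U ⊆ X'` is (pre)irreducible and nonempty, and its closure — all of `X'`, by density — is
  preirreducible (`IsPreirreducible.closure`).

Integral = irreducible + reduced (`isIntegral_of_irreducibleSpace_of_isReduced`).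
-/

-- single-problem summit: the doubled namespace component `ResolutionOfSingularities` is forced
set_option linter.dupNamespace false

noncomputable section

open CategoryTheory AlgebraicGeometry TopologicalSpace
open Literature.AlgebraicGeometry.Resolution

namespace Summit.ResolutionOfSingularities.ResolutionOfSingularities.Theorems.FRationalResolution

/-- **A model with domain stalks of an integral scheme is integral.** If `X` is integral,
`π : X' ⟶ X` restricts to an isomorphism `π ∣_ U : ↑(π ⁻¹ᵁ U) ⟶ ↑U` over a nonempty open `U` of `X`
whose preimage `π ⁻¹ᵁ U` is dense in `X'`, and all stalks of `X'` are domains, then `X'` is integral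
(reduced by the stalk condition; irreducible because the dense open `π ⁻¹ᵁ U ≅ U` is irreducible). -/
theorem isIntegral_of_model (X X' : Scheme.{0}) [IsIntegral X] (π : X' ⟶ X)
    (hdom : ∀ x : X', IsDomain (X'.presheaf.stalk x)) (U : X.Opens) (hUne : (U : Set X).Nonempty)
    (hiso : IsIso (π ∣_ U)) (hd : Dense ((π ⁻¹ᵁ U : X'.Opens) : Set X')) : IsIntegral X' := by
  haveI : IsReduced X' := isReduced_of_isDomain_stalk X' hdom
  obtain ⟨x, hx⟩ := hUne
  haveI : Nonempty (U : Scheme.{0}) := ⟨(⟨x, hx⟩ : U)⟩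
  haveI : IsIntegral (U : Scheme.{0}) := isIntegral_of_isOpenImmersion U.ι
  haveI : IsIntegral ((π ⁻¹ᵁ U : X'.Opens) : Scheme.{0}) := IsIntegral.of_isIso (inv (π ∣_ U))
  have hpre : IsPreirreducible ((π ⁻¹ᵁ U : X'.Opens) : Set X') := by
    rw [← Scheme.Opens.range_ι, ← Set.image_univ]
    exact (IrreducibleSpace.isIrreducible_univ _).isPreirreducible.image _
      (π ⁻¹ᵁ U).ι.continuous.continuousOn
  have hne : ((π ⁻¹ᵁ U : X'.Opens) : Set X').Nonempty := by
    rw [← Scheme.Opens.range_ι]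
    exact Set.range_nonempty _
  haveI : IrreducibleSpace X' :=
    { isPreirreducible_univ := by
        rw [← hd.closure_eq]
        exact hpre.closure
      toNonempty := ⟨hne.some⟩ }
  exact isIntegral_of_irreducibleSpace_of_isReduced X'

end Summit.ResolutionOfSingularities.ResolutionOfSingularities.Theorems.FRationalResolution

end
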